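import Mathlib
import Literature.Analysis.TotalPositivity.PolyaFrequencyJensenRoots

/-!
# Null-cone local rigidity — univariate core: real-rooted perturbations of `u^m`

Helper file for item `stmt-CriticalPhenomena-4275`
(`Summit.CriticalPhenomena.Ising3DConformalLimit.Theses.HyperoctahedralRP.NullConeLocalRigidity`).

Let `H = u^m + ε q(u)` with `q ∈ ℝ[u]`, `deg q ≤ m`, `m ≥ 2`, and leading coefficient
`L = 1 + ε q_m > 0`.  If every complex root of `H` is real, then with the real roots
`u_1, …, u_m` (Vieta) `Σ u_i = -ε q_{m-1}/L`, `e_2(u) = ε q_{m-2}/L`, `∏ u_i = ± ε q_0 / L`, and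
Newton's identity gives `S := Σ u_i^2 = (ε q_{m-1})^2/L^2 - 2 ε q_{m-2}/L ≥ 0`, while
`(∏ u_i)^2 ≤ S^m` (each `u_i^2 ≤ S`).  Hence

* `0 ≤ (ε q_{m-1})^2/L^2 - 2 ε q_{m-2}/L` and
* `(ε q_0/L)^2 ≤ ((ε q_{m-1})^2/L^2 - 2 ε q_{m-2}/L)^m`   (`realRooted_core`).

Along a sequence `ε_n → 0`, `ε_n ≠ 0` this forces `q_0 = 0` when `m ≥ 3`
(`coeff_zero_eq_zero_of_realRooted`) and `ε_n q_{m-2} ≤ K ε_n^2` eventually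
(`eventually_mul_coeff_le_of_realRooted`).  No Rouché / continuity of roots is used.
-/

noncomputable section

open Polynomial Filter Topology

namespace Summit.CriticalPhenomena.Ising3DConformalLimit.Theorems.NullConeLocalRigidity

/-- For a real multiset, `(∏ s)^2 ≤ (Σ s_i^2)^{#s}` (each `s_i^2 ≤ Σ s_j^2`). -/
theorem prod_sq_le_sum_sq_pow (s : Multiset ℝ) :
    s.prod ^ 2 ≤ (s.map (· ^ 2)).sum ^ Multiset.card s := by
  induction s using Multiset.induction_on with
  | empty => simp
  | cons a s ih =>
    have hT : 0 ≤ (s.map (· ^ 2)).sum :=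
      Multiset.sum_nonneg fun x hx => by
        obtain ⟨y, _, rfl⟩ := Multiset.mem_map.1 hx
        positivity
    simp only [Multiset.prod_cons, Multiset.map_cons, Multiset.sum_cons, Multiset.card_cons,
      pow_succ]
    calc (a * s.prod) ^ 2 = s.prod ^ 2 * a ^ 2 := by ring
      _ ≤ (s.map (· ^ 2)).sum ^ Multiset.card s * a ^ 2 :=
          mul_le_mul_of_nonneg_right ih (sq_nonneg a)
      _ ≤ (a ^ 2 + (s.map (· ^ 2)).sum) ^ Multiset.card s * (a ^ 2 + (s.map (· ^ 2)).sum) := by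
          apply mul_le_mul _ _ (sq_nonneg a) (by positivity)
          · exact pow_le_pow_left₀ hT (by nlinarith [sq_nonneg a]) _
          · linarith

/-- **Core inequality.** `H = u^m + ε q`, `deg q ≤ m`, `m ≥ 2`, `L = 1 + ε q_m > 0`, all complex
roots of `H` real ⟹ `0 ≤ S` and `(ε q_0 / L)^2 ≤ S^m` where
`S = (ε q_{m-1})^2/L^2 - 2 ε q_{m-2}/L` is the sum of the squares of the roots. -/
theorem realRooted_core {m : ℕ} (hm : 2 ≤ m) (q : ℝ[X]) (hq : q.natDegree ≤ m) (e : ℝ)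
    (hL : 0 < 1 + e * q.coeff m)
    (hreal : ∀ u : ℂ, aeval u ((X : ℝ[X]) ^ m + C e * q) = 0 → u.im = 0) :
    0 ≤ (e * q.coeff (m - 1)) ^ 2 / (1 + e * q.coeff m) ^ 2
          - 2 * (e * q.coeff (m - 2)) / (1 + e * q.coeff m) ∧
      (e * q.coeff 0 / (1 + e * q.coeff m)) ^ 2 ≤
        ((e * q.coeff (m - 1)) ^ 2 / (1 + e * q.coeff m) ^ 2
          - 2 * (e * q.coeff (m - 2)) / (1 + e * q.coeff m)) ^ m := by
  set L := 1 + e * q.coeff m with hLdef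
  set H : ℝ[X] := X ^ m + C e * q with hH
  have hcoeff : ∀ k, H.coeff k = (if k = m then 1 else 0) + e * q.coeff k := by
    intro k
    simp only [hH, coeff_add, coeff_X_pow, coeff_C_mul]
  have hdegle : H.natDegree ≤ m := by
    refine (natDegree_add_le _ _).trans (max_le (natDegree_X_pow_le _) ?_)
    exact (natDegree_C_mul_le _ _).trans hq
  have hcm : H.coeff m = L := by rw [hcoeff]; simp [hLdef]
  have hdeg : H.natDegree = m :=
    natDegree_eq_of_le_of_coeff_ne_zero hdegle (by rw [hcm]; exact hL.ne')
  have hlead : H.leadingCoeff = L := by rw [leadingCoeff, hdeg, hcm]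
  have hH0 : H ≠ 0 := by
    intro h
    rw [h, leadingCoeff_zero] at hlead
    exact hL.ne' hlead.symm
  -- `H` splits over `ℝ`: all complex roots are real.
  have hsplit : H.Splits := by
    refine Splits.of_splits_map_of_injective (i := algebraMap ℝ ℂ) (algebraMap ℝ ℂ).injective
      (IsAlgClosed.splits _) ?_
    intro a ha
    have hne : H.map (algebraMap ℝ ℂ) ≠ 0 := map_ne_zero hH0
    have ha' : Polynomial.eval a (H.map (algebraMap ℝ ℂ)) = 0 := (mem_roots hne).1 ha
    rw [eval_map_algebraMap] at ha'
    have him := hreal a ha'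
    exact ⟨a.re, Complex.ext (by simp) (by simp [him])⟩
  set R := H.roots with hR
  have hcard : Multiset.card R = m := by
    rw [hR, ← hsplit.natDegree_eq_card_roots, hdeg]
  -- Vieta: sum, e₂, product.
  have hsum : e * q.coeff (m - 1) = -L * R.sum := by
    have h1 := hsplit.nextCoeff_eq_neg_sum_roots_mul_leadingCoeff
    rw [nextCoeff_of_natDegree_pos (by omega), hdeg, hlead, hcoeff] at h1
    simpa [show m - 1 ≠ m by omega] using h1
  have he2 : e * q.coeff (m - 2) = L * R.esymm 2 := by
    have h1 := coeff_eq_esymm_roots_of_card (p := H) (by rw [hdeg, ← hcard]) (k := m - 2)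
      (by rw [hdeg]; omega)
    rw [hdeg, hlead, hcoeff, show m - (m - 2) = 2 by omega] at h1
    simpa [show m - 2 ≠ m by omega] using h1
  have hprod : e * q.coeff 0 = (-1) ^ m * L * R.prod := by
    have h1 := hsplit.coeff_zero_eq_leadingCoeff_mul_prod_roots
    rw [hdeg, hlead, hcoeff] at h1
    simpa [show (0 : ℕ) ≠ m by omega] using h1
  -- Newton: sum of squares.
  have hnewton := Literature.Analysis.TotalPositivity.sum_map_sq_eq R
  set S := (R.map fun a => a ^ 2).sum with hS
  have hS0 : 0 ≤ S :=
    Multiset.sum_nonneg fun x hx => by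
      obtain ⟨y, _, rfl⟩ := Multiset.mem_map.1 hx
      positivity
  have hLne : L ≠ 0 := hL.ne'
  have hRsum : R.sum = -(e * q.coeff (m - 1)) / L := by
    field_simp
    linarith [hsum]
  have hRe2 : R.esymm 2 = e * q.coeff (m - 2) / L := by
    field_simp
    linarith [he2]
  have hSeq : S = (e * q.coeff (m - 1)) ^ 2 / L ^ 2 - 2 * (e * q.coeff (m - 2)) / L := by
    rw [hnewton, hRsum, hRe2]
    ring
  have h1 : e * q.coeff 0 / L = (-1) ^ m * R.prod := by
    rw [hprod]
    field_simp
  have hprod2 : R.prod ^ 2 = (e * q.coeff 0 / L) ^ 2 := by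
    rw [h1, mul_pow, ← pow_mul, mul_comm m 2, pow_mul]
    norm_num
  refine ⟨hSeq ▸ hS0, ?_⟩
  rw [← hSeq, ← hprod2, ← hcard]
  exact prod_sq_le_sum_sq_pow R

/-- Division-free form of `realRooted_core`: with `L = 1 + ε q_m`,
`0 ≤ (ε q_{m-1})^2 - 2 ε q_{m-2} L` and `(ε q_0)^2 L^{2m-2} ≤ ((ε q_{m-1})^2 - 2 ε q_{m-2} L)^m`. -/
theorem realRooted_core' {m : ℕ} (hm : 2 ≤ m) (q : ℝ[X]) (hq : q.natDegree ≤ m) (e : ℝ)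
    (hL : 0 < 1 + e * q.coeff m)
    (hreal : ∀ u : ℂ, aeval u ((X : ℝ[X]) ^ m + C e * q) = 0 → u.im = 0) :
    0 ≤ (e * q.coeff (m - 1)) ^ 2 - 2 * (e * q.coeff (m - 2)) * (1 + e * q.coeff m) ∧
      (e * q.coeff 0) ^ 2 * (1 + e * q.coeff m) ^ (2 * m - 2) ≤
        ((e * q.coeff (m - 1)) ^ 2 - 2 * (e * q.coeff (m - 2)) * (1 + e * q.coeff m)) ^ m := by
  obtain ⟨h0, h1⟩ := realRooted_core hm q hq e hL hreal
  set L := 1 + e * q.coeff m with hLdef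
  have hLne : L ≠ 0 := hL.ne'
  set A := (e * q.coeff (m - 1)) ^ 2
  set B := e * q.coeff (m - 2)
  have hS : A / L ^ 2 - 2 * B / L = (A - 2 * B * L) / L ^ 2 := by
    field_simp
  rw [hS] at h0 h1
  constructor
  · have := mul_nonneg h0 (sq_nonneg L)
    rwa [div_mul_cancel₀ _ (pow_ne_zero 2 hLne)] at this
  · rw [div_pow, div_pow, ← pow_mul, div_le_div_iff₀ (by positivity) (by positivity)] at h1
    have h2 : (e * q.coeff 0) ^ 2 * L ^ (2 * m - 2) * L ^ 2 ≤ (A - 2 * B * L) ^ m * L ^ 2 := by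
      calc (e * q.coeff 0) ^ 2 * L ^ (2 * m - 2) * L ^ 2
          = (e * q.coeff 0) ^ 2 * L ^ (2 * m) := by
            rw [mul_assoc, ← pow_add, show 2 * m - 2 + 2 = 2 * m by omega]
        _ ≤ (A - 2 * B * L) ^ m * L ^ 2 := h1
    exact le_of_mul_le_mul_right h2 (by positivity)

/-- **Vanishing of the constant term (`m ≥ 3`).** If `u^m + ε_n q(u)` has only real complex roots
for a real sequence `ε_n → 0`, `ε_n ≠ 0`, and `deg q ≤ m`, `m ≥ 3`, then `q(0) = 0`. -/
theorem coeff_zero_eq_zero_of_realRooted {m : ℕ} (hm : 3 ≤ m) (q : ℝ[X]) (hq : q.natDegree ≤ m)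
    (ε : ℕ → ℝ) (hε : Tendsto ε atTop (𝓝[≠] 0))
    (hreal : ∀ (n : ℕ) (u : ℂ), aeval u ((X : ℝ[X]) ^ m + C (ε n) * q) = 0 → u.im = 0) :
    q.coeff 0 = 0 := by
  by_contra hq0
  obtain ⟨hε0, hne⟩ := tendsto_nhdsWithin_iff.1 hε
  set K := (q.coeff (m - 1)) ^ 2 + 3 * |q.coeff (m - 2)| with hK
  have hK0 : 0 ≤ K := by positivity
  have habs : Tendsto (fun n => |ε n|) atTop (𝓝 0) := by
    simpa using hε0.abs
  have h1 : ∀ᶠ n in atTop, |ε n| ≤ 1 := habs.eventually_le_const one_pos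
  have h2 : ∀ᶠ n in atTop, |ε n * q.coeff m| ≤ 1 / 2 := by
    have : Tendsto (fun n => |ε n * q.coeff m|) atTop (𝓝 0) := by
      simpa using (hε0.mul_const (q.coeff m)).abs
    exact this.eventually_le_const (by norm_num)
  have hc : 0 < (q.coeff 0) ^ 2 * (1 / 2 : ℝ) ^ (2 * m - 2) := by positivity
  have h3 : ∀ᶠ n in atTop, K ^ m * |ε n| ^ (m - 2) < (q.coeff 0) ^ 2 * (1 / 2 : ℝ) ^ (2 * m - 2) := by
    have : Tendsto (fun n => K ^ m * |ε n| ^ (m - 2)) atTop (𝓝 0) := by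
      have h := (habs.pow (m - 2)).const_mul (K ^ m)
      rwa [zero_pow (by omega), mul_zero] at h
    exact this.eventually_lt_const hc
  obtain ⟨n, hn0, hn1, hn2, hn3⟩ := (hne.and (h1.and (h2.and h3))).exists
  have hn0' : ε n ≠ 0 := hn0
  obtain ⟨hl1, hl2⟩ := abs_le.1 hn2
  have hL : 0 < 1 + ε n * q.coeff m := by linarith
  obtain ⟨hA, hineq⟩ := realRooted_core' (by omega) q hq (ε n) hL (hreal n)
  set L := 1 + ε n * q.coeff m with hLdef
  set t := |ε n| with ht
  have ht0 : 0 < t := abs_pos.2 hn0'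
  -- upper bound for the bracket
  have hbr : (ε n * q.coeff (m - 1)) ^ 2 - 2 * (ε n * q.coeff (m - 2)) * L ≤ K * t := by
    have e1 : (ε n * q.coeff (m - 1)) ^ 2 ≤ t * (q.coeff (m - 1)) ^ 2 := by
      rw [mul_pow, ← sq_abs (ε n)]
      have : t ^ 2 ≤ t := by nlinarith
      nlinarith [sq_nonneg (q.coeff (m - 1))]
    have e2 : -(2 * (ε n * q.coeff (m - 2)) * L) ≤ 3 * (t * |q.coeff (m - 2)|) := by
      have : |2 * (ε n * q.coeff (m - 2)) * L| ≤ 3 * (t * |q.coeff (m - 2)|) := by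
        rw [abs_mul, abs_mul, abs_mul, abs_of_pos hL]
        have : |(2 : ℝ)| = 2 := abs_of_pos two_pos
        rw [this, ← ht]
        have hL32 : L ≤ 3 / 2 := by linarith
        have htq : 0 ≤ t * |q.coeff (m - 2)| := mul_nonneg ht0.le (abs_nonneg _)
        nlinarith
      linarith [neg_abs_le (2 * (ε n * q.coeff (m - 2)) * L)]
    rw [hK]
    linarith
  -- lower bound for the left-hand side
  have hlow : (ε n * q.coeff 0) ^ 2 * (1 / 2 : ℝ) ^ (2 * m - 2) ≤
      (ε n * q.coeff 0) ^ 2 * L ^ (2 * m - 2) := by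
    apply mul_le_mul_of_nonneg_left _ (sq_nonneg _)
    exact pow_le_pow_left₀ (by norm_num) (by linarith) _
  have hup : ((ε n * q.coeff (m - 1)) ^ 2 - 2 * (ε n * q.coeff (m - 2)) * L) ^ m ≤ (K * t) ^ m :=
    pow_le_pow_left₀ hA hbr m
  have hchain : (ε n * q.coeff 0) ^ 2 * (1 / 2 : ℝ) ^ (2 * m - 2) ≤ K ^ m * t ^ (m - 2) * t ^ 2 := by
    calc (ε n * q.coeff 0) ^ 2 * (1 / 2 : ℝ) ^ (2 * m - 2)
        ≤ (K * t) ^ m := hlow.trans (hineq.trans hup)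
      _ = K ^ m * t ^ (m - 2) * t ^ 2 := by
        rw [mul_pow, mul_assoc, ← pow_add, show m - 2 + 2 = m by omega]
  have ht2 : t ^ 2 = (ε n) ^ 2 := sq_abs _
  rw [ht2] at hchain
  have : (q.coeff 0) ^ 2 * (1 / 2 : ℝ) ^ (2 * m - 2) * (ε n) ^ 2 ≤
      K ^ m * t ^ (m - 2) * (ε n) ^ 2 := by
    calc (q.coeff 0) ^ 2 * (1 / 2 : ℝ) ^ (2 * m - 2) * (ε n) ^ 2
        = (ε n * q.coeff 0) ^ 2 * (1 / 2 : ℝ) ^ (2 * m - 2) := by ring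
      _ ≤ _ := hchain
  have hε2 : 0 < (ε n) ^ 2 := by positivity
  have := le_of_mul_le_mul_right this hε2
  linarith

/-- **Sign condition on `q_{m-2}`.** Under the same hypotheses (`m ≥ 2`), eventually
`ε_n q_{m-2} ≤ q_{m-1}^2 ε_n^2`. -/
theorem eventually_mul_coeff_le_of_realRooted {m : ℕ} (hm : 2 ≤ m) (q : ℝ[X])
    (hq : q.natDegree ≤ m) (ε : ℕ → ℝ) (hε : Tendsto ε atTop (𝓝[≠] 0))
    (hreal : ∀ (n : ℕ) (u : ℂ), aeval u ((X : ℝ[X]) ^ m + C (ε n) * q) = 0 → u.im = 0) :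
    ∀ᶠ n in atTop, ε n * q.coeff (m - 2) ≤ (q.coeff (m - 1)) ^ 2 * (ε n) ^ 2 := by
  obtain ⟨hε0, -⟩ := tendsto_nhdsWithin_iff.1 hε
  have h2 : ∀ᶠ n in atTop, |ε n * q.coeff m| ≤ 1 / 2 := by
    have : Tendsto (fun n => |ε n * q.coeff m|) atTop (𝓝 0) := by
      simpa using (hε0.mul_const (q.coeff m)).abs
    exact this.eventually_le_const (by norm_num)
  filter_upwards [h2] with n hn2
  obtain ⟨hl1, hl2⟩ := abs_le.1 hn2
  have hL : 0 < 1 + ε n * q.coeff m := by linarith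
  obtain ⟨hA, -⟩ := realRooted_core' hm q hq (ε n) hL (hreal n)
  -- `2 (ε q_{m-2}) L ≤ (ε q_{m-1})^2` with `2L ≥ 1`
  have hsq : (ε n * q.coeff (m - 1)) ^ 2 = (q.coeff (m - 1)) ^ 2 * (ε n) ^ 2 := by ring
  rcases le_or_gt 0 (ε n * q.coeff (m - 2)) with h | h
  · nlinarith
  · nlinarith [sq_nonneg (ε n * q.coeff (m - 1))]

end Summit.CriticalPhenomena.Ising3DConformalLimit.Theorems.NullConeLocalRigidity

end
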